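import Mathlib
import HarnessLib
import Literature.Analysis.FluidPDE.VectorCalculus
import Literature.Analysis.FluidPDE.LerayProfileCalculus
import Literature.Analysis.FluidPDE.TypeIAncientMildClassical
import Summits.NavierStokesRegularity.NavierStokesRegularity.Theorems.LocalSineTubeDoorProfileAlignedWindowRigidityAncient
import Summits.NavierStokesRegularity.NavierStokesRegularity.Theorems.PoloidalWindowDoorPoloidalWindowRigidityWindow
import Summits.NavierStokesRegularity.NavierStokesRegularity.Theorems.PoloidalWindowDoorPoloidalWindowRigidityFlat
import Summits.NavierStokesRegularity.NavierStokesRegularity.Theorems.LocalSineTubeDoorBoundedSubsolutionMaxPrinciple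

/-!
# Door S11 `LocalTubeDoorHelicity`, crux K2⁗ `FrobeniusProfileRigidity` (stmt-NavierStokesRegularity-19975) — two
# ONE-SIDED energy strata of the Type-I profile class: head non-decreasing along streamlines, and adverse pressure
# gradient everywhere, each force `v ≡ 0`

Cell ns-regularity-ideate, stub-worker `ns-helicity-19975-w1` under the K2⁗ lead nsreg-p6 (lands
`--supports stmt-NavierStokesRegularity-19975 --as helper`; no claim).  One-sided versions of the Bernoulli stratum
(`…FrobeniusProfileRigidityBernoulli.eq_zero_of_bernoulli`, `⟪v, ∂ₜv⟫ = ⟪v, Δv⟫`) and of the affine-pressure stratum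
(`…PoloidalWindowRigidityConstantPressureGradient.eq_zero_of_constantPressureGradient`, `∇p = ∇p(t)`), for a profile
`v` of the door family's Type-I class (rate `C/√(−t)`, continuity on the open slab, unit-viscosity Oseen–Duhamel
identity, divergence-free slices); `H = p + |v|²/2` is the Bernoulli head of any classical pressure `p`:

* **HEAD NON-DECREASING ALONG STREAMLINES ⇒ trivial** (`eq_zero_of_head_nondecreasing`): if `v·∇H ≥ 0` on every slice
  — pressure-free form `⟪v, ∂ₜv⟫ ≤ ⟪v, Δv⟫` (momentum equation: `v·∇H = −⟪v, ∂ₜv − Δv⟫`) — then `v ≡ 0`: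
  `∂ₜ|v|² − Δ|v|² = 2⟪v, ∂ₜv − Δv⟫ − 2|Dv|²_F ≤ 0`, a bounded HEAT sub-solution with `|v|² ≤ C²/(−t)`;
* **ADVERSE PRESSURE GRADIENT EVERYWHERE ⇒ trivial** (`eq_zero_of_pressure_nondecreasing`): if `v·∇p ≥ 0` on every
  slice — pressure-free form `⟪v, ∂ₜv + (v·∇)v⟫ ≤ ⟪v, Δv⟫` — then `v ≡ 0`:
  `∂ₜ|v|² + (v·∇)|v|² − Δ|v|² = −2 v·∇p − 2|Dv|²_F ≤ 0`, a bounded sub-solution of the drift–diffusion inequality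
  with the bounded drift `v`;

both by the whole-space maximum principle for bounded sub-solutions (`le_of_bounded_subsolution`) on slabs
`[t₀, t₁] × ℝ³` and `t₀ → −∞`.  Pressure forms (`eq_zero_of_head_nondecreasing_pressure`,
`eq_zero_of_pressure_nondecreasing_pressure`) and the not-backward-singular corollaries are included.  The regularity
(time-differentiability, `C²` slices) is KNSS's for the class (`isTypeIAncientMild_of_class`), which is where the
Oseen–Duhamel identity is consumed.

WHAT THIS IS NOT: not a claim about Navier–Stokes regularity, not K2⁗ — two more settled (one-sided, dynamic) strata
of the Type-I profile class (bears_on LADDER-NS N0, door S11 support).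
-/

noncomputable section

-- the summit and its single sub-problem share the name (CONVENTIONS §1), as in every Theorems file
set_option linter.dupNamespace false

namespace Summit.NavierStokesRegularity.NavierStokesRegularity.Theorems.LocalHelicityTubeDoorFrobeniusProfileRigidityHeadMonotone

open MeasureTheory Set Function Filter Topology TopologicalSpace Metric InnerProductSpace
open scoped RealInnerProductSpace InnerProductSpace Laplacian ContDiff
open Literature.Analysis Literature.Analysis.FluidPDE
open Summit.NavierStokesRegularity.NavierStokesRegularity.Theorems.LocalSineTubeDoorProfileAlignedWindowRigidityAncient
open Summit.NavierStokesRegularity.NavierStokesRegularity.Theorems.PoloidalWindowDoorPoloidalWindowRigidityWindow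
open Summit.NavierStokesRegularity.NavierStokesRegularity.Theorems.PoloidalWindowDoorPoloidalWindowRigidityFlat
open Summit.NavierStokesRegularity.NavierStokesRegularity.Theorems.LocalSineTubeDoorBoundedSubsolutionMaxPrinciple

variable {C : ℝ} {v : ℝ → EuclideanSpace ℝ (Fin 3) → EuclideanSpace ℝ (Fin 3)}

/-! ### a common maximum-principle wrapper: `|v|²` a sub-solution with drift `b` (`b = 0` or `b = v`) -/

/-- **If `|v|²` is a sub-solution of `∂ₜq + Dq(b) − Δq ≤ 0` on the open slab for a drift `b` bounded on every slab
`[t₀, t₁]`, `t₁ < 0`, then a profile of the Type-I class vanishes identically** (whole-space maximum principle for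
bounded sub-solutions on `[t₀, t₁] × ℝ³` with the rate bounds `|v(t)|² ≤ C²/(−t)`, then `t₀ → −∞`). -/
theorem eq_zero_of_normSq_subsolution (hrate : HasTypeITimeDecay C v)
    (hcont : ContinuousOn (uncurry v) (Iio (0 : ℝ) ×ˢ univ))
    (hmild : ∀ s t : ℝ, s < t → t < 0 → ∀ x,
      v t x = UnboundedOperators.heatExtension (v s) (t - s) x - oseenDuhamel 1 s v v t x)
    (hdiv : ∀ t < 0, VectorCalculus.IsDivFree (v t))
    {b : ℝ → EuclideanSpace ℝ (Fin 3) → EuclideanSpace ℝ (Fin 3)}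
    (hb : ∀ t₁ < 0, ∃ A : ℝ, ∀ t ≤ t₁, ∀ x, ‖b t x‖ ≤ A)
    (hsub : ∀ t < 0, ∀ x,
      HasDerivAt (fun τ => ⟪v τ x, v τ x⟫_ℝ) (deriv (fun τ => ⟪v τ x, v τ x⟫_ℝ) t) t ∧
        deriv (fun τ => ⟪v τ x, v τ x⟫_ℝ) t + fderiv ℝ (fun y => ⟪v t y, v t y⟫_ℝ) x (b t x) -
          (Δ (fun y => ⟪v t y, v t y⟫_ℝ)) x ≤ 0) :
    ∀ t < 0, ∀ x, v t x = 0 := by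
  have hA : IsTypeIAncientMild C v := isTypeIAncientMild_of_class hrate hcont hmild hdiv
  have hsm : IsSmoothSpaceTimeOn (Iio 0) v := hA.contDiffOn
  set q : ℝ → EuclideanSpace ℝ (Fin 3) → ℝ := fun τ y => ⟪v τ y, v τ y⟫_ℝ with hqdef
  set qt : ℝ → EuclideanSpace ℝ (Fin 3) → ℝ := fun τ y => deriv (fun τ' => q τ' y) τ with hqtdef
  have hqbd : ∀ t < 0, ∀ x, q t x ≤ C ^ 2 / (-t) := fun t ht x => by
    have h1 : ‖v t x‖ ^ 2 ≤ (C / Real.sqrt (-t)) ^ 2 := pow_le_pow_left₀ (norm_nonneg _) (hrate t ht x) 2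
    rw [div_pow, Real.sq_sqrt (by linarith)] at h1
    simpa only [hqdef, real_inner_self_eq_norm_sq] using h1
  intro t₁ ht₁ x₁
  have hkey : ∀ t₀ < t₁, q t₁ x₁ ≤ C ^ 2 / (-t₀) := by
    intro t₀ ht₀
    obtain ⟨A, hA'⟩ := hb t₁ ht₁
    have hbA : ∀ t ∈ Icc t₀ t₁, ∀ x, ‖b t x‖ ≤ A := fun t ht x => hA' t ht.2 x
    have hq_c : ContinuousOn (uncurry q) (Icc t₀ t₁ ×ˢ univ) := by
      have hvc : ContinuousOn (uncurry v) (Icc t₀ t₁ ×ˢ univ) :=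
        hcont.mono (prod_mono (fun t ht => lt_of_le_of_lt ht.2 ht₁) Subset.rfl)
      have h : ContinuousOn (fun z => ⟪uncurry v z, uncurry v z⟫_ℝ) (Icc t₀ t₁ ×ˢ univ) := hvc.inner hvc
      refine h.congr fun z _ => ?_
      simp only [hqdef, uncurry]
    have hq2 : ∀ t ∈ Icc t₀ t₁, ContDiff ℝ 2 (q t) := fun t ht => by
      have htn : t < 0 := lt_of_le_of_lt ht.2 ht₁
      have hV : ContDiff ℝ 2 (v t) := contDiff_infty.1 (hsm.contDiff_slice htn) 2
      exact hV.inner ℝ hV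
    have hqt : ∀ x, ∀ t ∈ Icc t₀ t₁, HasDerivAt (fun τ => q τ x) (qt t x) t :=
      fun x t ht => (hsub t (lt_of_le_of_lt ht.2 ht₁) x).1
    have hlaw : ∀ t ∈ Icc t₀ t₁, ∀ x, qt t x + fderiv ℝ (q t) x (b t x) - (Δ (q t)) x ≤ 0 :=
      fun t ht x => (hsub t (lt_of_le_of_lt ht.2 ht₁) x).2
    have hbdd : ∀ t ∈ Icc t₀ t₁, ∀ x, |q t x| ≤ C ^ 2 / (-t₁) := fun t ht x => by
      have htn : t < 0 := lt_of_le_of_lt ht.2 ht₁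
      have hq0 : 0 ≤ q t x := by simp only [hqdef]; exact real_inner_self_nonneg
      rw [abs_of_nonneg hq0]
      refine (hqbd t htn x).trans ?_
      exact div_le_div_of_nonneg_left (sq_nonneg C) (by linarith) (by linarith [ht.2])
    have hinit : ∀ x, q t₀ x ≤ C ^ 2 / (-t₀) := fun x => hqbd t₀ (ht₀.trans ht₁) x
    exact le_of_bounded_subsolution ht₀ hbA hq_c hq2 hqt hlaw hbdd hinit t₁ ⟨ht₀.le, le_rfl⟩ x₁
  have hq0 : 0 ≤ q t₁ x₁ := by simp only [hqdef]; exact real_inner_self_nonneg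
  have hqle : q t₁ x₁ ≤ 0 := by
    refine le_of_forall_pos_le_add fun η hη => ?_
    set t₀ : ℝ := t₁ - 1 - C ^ 2 / η with ht₀def
    have hq' : 0 ≤ C ^ 2 / η := div_nonneg (sq_nonneg C) hη.le
    have ht₀ : t₀ < t₁ := by rw [ht₀def]; linarith
    have hnt₀ : C ^ 2 / η ≤ -t₀ := by rw [ht₀def]; linarith
    have hpos : 0 < -t₀ := by linarith
    have h1 : C ^ 2 / (-t₀) ≤ η := by
      rw [div_le_iff₀ hpos]
      calc C ^ 2 = C ^ 2 / η * η := by field_simp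
        _ ≤ -t₀ * η := mul_le_mul_of_nonneg_right hnt₀ hη.le
        _ = η * -t₀ := mul_comm _ _
    linarith [hkey t₀ ht₀]
  have hq00 : q t₁ x₁ = 0 := le_antisymm hqle hq0
  simpa only [hqdef, inner_self_eq_zero] using hq00

/-- Time derivative of `|v|²` at a point of the open slab, for a profile of the class: it exists and equals
`2⟪v, ∂ₜv⟫`; and `Δ|v|² = 2⟪Δv, v⟫ + 2|Dv|²_F`. -/
theorem hasDerivAt_normSq (hrate : HasTypeITimeDecay C v)
    (hcont : ContinuousOn (uncurry v) (Iio (0 : ℝ) ×ˢ univ))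
    (hmild : ∀ s t : ℝ, s < t → t < 0 → ∀ x,
      v t x = UnboundedOperators.heatExtension (v s) (t - s) x - oseenDuhamel 1 s v v t x)
    (hdiv : ∀ t < 0, VectorCalculus.IsDivFree (v t)) {t : ℝ} (ht : t < 0) (x : EuclideanSpace ℝ (Fin 3)) :
    HasDerivAt (fun τ => ⟪v τ x, v τ x⟫_ℝ) (deriv (fun τ => ⟪v τ x, v τ x⟫_ℝ) t) t ∧
      deriv (fun τ => ⟪v τ x, v τ x⟫_ℝ) t = 2 * ⟪v t x, deriv (fun τ => v τ x) t⟫_ℝ ∧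
      (Δ (fun y => ⟪v t y, v t y⟫_ℝ)) x = 2 * ⟪(Δ (v t)) x, v t x⟫_ℝ + 2 * frobeniusNormSq (fderiv ℝ (v t) x) := by
  have hA : IsTypeIAncientMild C v := isTypeIAncientMild_of_class hrate hcont hmild hdiv
  have hsm : IsSmoothSpaceTimeOn (Iio 0) v := hA.contDiffOn
  have hV2 : ContDiff ℝ 2 (v t) := contDiff_infty.1 (hsm.contDiff_slice ht) 2
  have hdv : HasDerivAt (fun τ => v τ x) (deriv (fun τ => v τ x) t) t :=
    ((hsm.differentiableWithinAt_time ht x).differentiableAt (isOpen_Iio.mem_nhds ht)).hasDerivAt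
  have hq : HasDerivAt (fun τ => ⟪v τ x, v τ x⟫_ℝ)
      (⟪v t x, deriv (fun τ => v τ x) t⟫_ℝ + ⟪deriv (fun τ => v τ x) t, v t x⟫_ℝ) t := hdv.inner ℝ hdv
  refine ⟨hq.differentiableAt.hasDerivAt, ?_, laplacian_inner_self_eq hV2 x⟩
  rw [hq.deriv, real_inner_comm (v t x), ← two_mul]

/-! ### head non-decreasing along streamlines -/

/-- **HEAD NON-DECREASING ALONG STREAMLINES ⇒ TRIVIAL.**  A profile of the Type-I class with `⟪v, ∂ₜv⟫ ≤ ⟪v, Δv⟫`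
pointwise on the open slab — for any classical pressure this says `v·∇(p + |v|²/2) ≥ 0`, the Bernoulli head does not
decrease along streamlines — vanishes identically (`|v|²` is a bounded heat sub-solution: `∂ₜ|v|² − Δ|v|² =
2⟪v, ∂ₜv − Δv⟫ − 2|Dv|²_F ≤ 0`). -/
theorem eq_zero_of_head_nondecreasing (hrate : HasTypeITimeDecay C v)
    (hcont : ContinuousOn (uncurry v) (Iio (0 : ℝ) ×ˢ univ))
    (hmild : ∀ s t : ℝ, s < t → t < 0 → ∀ x,
      v t x = UnboundedOperators.heatExtension (v s) (t - s) x - oseenDuhamel 1 s v v t x)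
    (hdiv : ∀ t < 0, VectorCalculus.IsDivFree (v t))
    (hle : ∀ s < 0, ∀ y, ⟪v s y, deriv (fun τ => v τ y) s⟫_ℝ ≤ ⟪v s y, (Δ (v s)) y⟫_ℝ) :
    ∀ t < 0, ∀ x, v t x = 0 := by
  refine eq_zero_of_normSq_subsolution hrate hcont hmild hdiv (b := fun _ _ => 0)
    (fun t₁ _ => ⟨0, fun t _ x => by simp⟩) fun t ht x => ?_
  obtain ⟨hq, hderiv, hL⟩ := hasDerivAt_normSq hrate hcont hmild hdiv ht x
  refine ⟨hq, ?_⟩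
  have h0 : fderiv ℝ (fun y => ⟪v t y, v t y⟫_ℝ) x ((fun (_ : ℝ) (_ : EuclideanSpace ℝ (Fin 3)) =>
      (0 : EuclideanSpace ℝ (Fin 3))) t x) = 0 := by simp
  rw [h0, add_zero, hderiv, hL, real_inner_comm (v t x)]
  have h1 := frobeniusNormSq_nonneg (fderiv ℝ (v t) x)
  have h2 := hle t ht x
  linarith

/-- **Head non-decreasing along streamlines ⇒ not backward-singular.** -/
theorem not_backwardSingular_of_head_nondecreasing (hrate : HasTypeITimeDecay C v)
    (hcont : ContinuousOn (uncurry v) (Iio (0 : ℝ) ×ˢ univ))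
    (hmild : ∀ s t : ℝ, s < t → t < 0 → ∀ x,
      v t x = UnboundedOperators.heatExtension (v s) (t - s) x - oseenDuhamel 1 s v v t x)
    (hdiv : ∀ t < 0, VectorCalculus.IsDivFree (v t))
    (hle : ∀ s < 0, ∀ y, ⟪v s y, deriv (fun τ => v τ y) s⟫_ℝ ≤ ⟪v s y, (Δ (v s)) y⟫_ℝ) :
    ¬ IsBackwardSingularPoint v 0 :=
  not_backwardSingular_of_zero (eq_zero_of_head_nondecreasing hrate hcont hmild hdiv hle)

/-- **Pressure form**: if on every slice `s < 0`, for some classical pressure `p` on a window `(t₀,0) ∋ s`, the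
streamline derivative of the head is non-negative, `0 ≤ ⟪v, ∇p⟫ + ⟪v, (v·∇)v⟫`, then `v ≡ 0`. -/
theorem eq_zero_of_head_nondecreasing_pressure (hrate : HasTypeITimeDecay C v)
    (hcont : ContinuousOn (uncurry v) (Iio (0 : ℝ) ×ˢ univ))
    (hmild : ∀ s t : ℝ, s < t → t < 0 → ∀ x,
      v t x = UnboundedOperators.heatExtension (v s) (t - s) x - oseenDuhamel 1 s v v t x)
    (hdiv : ∀ t < 0, VectorCalculus.IsDivFree (v t))
    (hhead : ∀ s < 0, ∃ t₀ < s, ∃ p : ℝ → EuclideanSpace ℝ (Fin 3) → ℝ,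
      IsClassicalNSSolutionOn (Ioo t₀ 0) 1 0 v p ∧
        ∀ y, 0 ≤ ⟪v s y, gradient (p s) y⟫_ℝ + ⟪v s y, convect (v s) (v s) y⟫_ℝ) :
    ∀ t < 0, ∀ x, v t x = 0 := by
  refine eq_zero_of_head_nondecreasing hrate hcont hmild hdiv fun s hs y => ?_
  obtain ⟨t₀, ht₀, p, hcl, hh⟩ := hhead s hs
  have hsI : s ∈ Ioo t₀ 0 := ⟨ht₀, hs⟩
  have hM := hcl.momentum s hsI y
  rw [timeDerivWithin_apply, derivWithin_of_isOpen isOpen_Ioo hsI] at hM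
  have h := congrArg (fun z => ⟪v s y, z⟫_ℝ) hM
  simp only [inner_add_right, inner_sub_right, one_smul, Pi.zero_apply, add_zero] at h
  linarith [hh y]

/-! ### adverse pressure gradient everywhere -/

/-- **ADVERSE PRESSURE GRADIENT EVERYWHERE ⇒ TRIVIAL.**  A profile of the Type-I class with
`⟪v, ∂ₜv + (v·∇)v⟫ ≤ ⟪v, Δv⟫` pointwise on the open slab — for any classical pressure this says `v·∇p ≥ 0`, the flow is
everywhere directed toward non-decreasing pressure — vanishes identically (`|v|²` is a bounded sub-solution of
`∂ₜq + (v·∇)q − Δq ≤ 0` with the bounded drift `v`: the left side equals `−2 v·∇p − 2|Dv|²_F`).  One-sided extension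
of the affine-pressure stratum `∇p = ∇p(t)` (`…ConstantPressureGradient.eq_zero_of_constantPressureGradient`, where
`v·∇p(t)` has no sign but the gradient rate is used instead). -/
theorem eq_zero_of_pressure_nondecreasing (hrate : HasTypeITimeDecay C v)
    (hcont : ContinuousOn (uncurry v) (Iio (0 : ℝ) ×ˢ univ))
    (hmild : ∀ s t : ℝ, s < t → t < 0 → ∀ x,
      v t x = UnboundedOperators.heatExtension (v s) (t - s) x - oseenDuhamel 1 s v v t x)
    (hdiv : ∀ t < 0, VectorCalculus.IsDivFree (v t))
    (hle : ∀ s < 0, ∀ y,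
      ⟪v s y, deriv (fun τ => v τ y) s + convect (v s) (v s) y⟫_ℝ ≤ ⟪v s y, (Δ (v s)) y⟫_ℝ) :
    ∀ t < 0, ∀ x, v t x = 0 := by
  have hA : IsTypeIAncientMild C v := isTypeIAncientMild_of_class hrate hcont hmild hdiv
  have hsm : IsSmoothSpaceTimeOn (Iio 0) v := hA.contDiffOn
  refine eq_zero_of_normSq_subsolution hrate hcont hmild hdiv (b := v) (fun t₁ ht₁ => ?_) fun t ht x => ?_
  · obtain ⟨B, hB⟩ := bdd_of_hasTypeITimeDecay hrate (-t₁ / 2) (by linarith)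
    exact ⟨B, fun t ht x => hB t (by linarith) x⟩
  · obtain ⟨hq, hderiv, hL⟩ := hasDerivAt_normSq hrate hcont hmild hdiv ht x
    refine ⟨hq, ?_⟩
    have hVd : DifferentiableAt ℝ (v t) x :=
      ((hsm.contDiff_slice ht).differentiable (by simp)) x
    have hX : fderiv ℝ (fun y => ⟪v t y, v t y⟫_ℝ) x (v t x) = 2 * ⟪v t x, convect (v t) (v t) x⟫_ℝ := by
      rw [fderiv_inner_apply ℝ hVd hVd (v t x), convect_apply, real_inner_comm (v t x), two_mul]
    rw [hderiv, hX, hL, real_inner_comm (v t x)]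
    have h1 := frobeniusNormSq_nonneg (fderiv ℝ (v t) x)
    have h2 := hle t ht x
    rw [inner_add_right] at h2
    linarith

/-- **Adverse pressure gradient everywhere ⇒ not backward-singular.** -/
theorem not_backwardSingular_of_pressure_nondecreasing (hrate : HasTypeITimeDecay C v)
    (hcont : ContinuousOn (uncurry v) (Iio (0 : ℝ) ×ˢ univ))
    (hmild : ∀ s t : ℝ, s < t → t < 0 → ∀ x,
      v t x = UnboundedOperators.heatExtension (v s) (t - s) x - oseenDuhamel 1 s v v t x)
    (hdiv : ∀ t < 0, VectorCalculus.IsDivFree (v t))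
    (hle : ∀ s < 0, ∀ y,
      ⟪v s y, deriv (fun τ => v τ y) s + convect (v s) (v s) y⟫_ℝ ≤ ⟪v s y, (Δ (v s)) y⟫_ℝ) :
    ¬ IsBackwardSingularPoint v 0 :=
  not_backwardSingular_of_zero (eq_zero_of_pressure_nondecreasing hrate hcont hmild hdiv hle)

/-- **Pressure form**: if on every slice `s < 0`, for some classical pressure `p` on a window `(t₀,0) ∋ s`,
`0 ≤ ⟪v(s,y), ∇p(s,y)⟫` for all `y`, then `v ≡ 0`.  In particular (sign-free special cases): `v ⊥ ∇p` on every slice,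
or `∇p ≡ 0` (viscous Burgers profiles). -/
theorem eq_zero_of_pressure_nondecreasing_pressure (hrate : HasTypeITimeDecay C v)
    (hcont : ContinuousOn (uncurry v) (Iio (0 : ℝ) ×ˢ univ))
    (hmild : ∀ s t : ℝ, s < t → t < 0 → ∀ x,
      v t x = UnboundedOperators.heatExtension (v s) (t - s) x - oseenDuhamel 1 s v v t x)
    (hdiv : ∀ t < 0, VectorCalculus.IsDivFree (v t))
    (hp : ∀ s < 0, ∃ t₀ < s, ∃ p : ℝ → EuclideanSpace ℝ (Fin 3) → ℝ,
      IsClassicalNSSolutionOn (Ioo t₀ 0) 1 0 v p ∧ ∀ y, 0 ≤ ⟪v s y, gradient (p s) y⟫_ℝ) :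
    ∀ t < 0, ∀ x, v t x = 0 := by
  refine eq_zero_of_pressure_nondecreasing hrate hcont hmild hdiv fun s hs y => ?_
  obtain ⟨t₀, ht₀, p, hcl, hh⟩ := hp s hs
  have hsI : s ∈ Ioo t₀ 0 := ⟨ht₀, hs⟩
  have hM := hcl.momentum s hsI y
  rw [timeDerivWithin_apply, derivWithin_of_isOpen isOpen_Ioo hsI] at hM
  -- `∂ₜv + (v·∇)v = Δv − ∇p`
  have h := congrArg (fun z => ⟪v s y, z⟫_ℝ) hM
  simp only [inner_add_right, inner_sub_right, one_smul, Pi.zero_apply, add_zero] at h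
  rw [inner_add_right]
  linarith [hh y]

/-- **Pressure form, not backward-singular** (covers `∇p ≡ 0` and `v ⊥ ∇p`). -/
theorem not_backwardSingular_of_pressure_nondecreasing_pressure (hrate : HasTypeITimeDecay C v)
    (hcont : ContinuousOn (uncurry v) (Iio (0 : ℝ) ×ˢ univ))
    (hmild : ∀ s t : ℝ, s < t → t < 0 → ∀ x,
      v t x = UnboundedOperators.heatExtension (v s) (t - s) x - oseenDuhamel 1 s v v t x)
    (hdiv : ∀ t < 0, VectorCalculus.IsDivFree (v t))
    (hp : ∀ s < 0, ∃ t₀ < s, ∃ p : ℝ → EuclideanSpace ℝ (Fin 3) → ℝ,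
      IsClassicalNSSolutionOn (Ioo t₀ 0) 1 0 v p ∧ ∀ y, 0 ≤ ⟪v s y, gradient (p s) y⟫_ℝ) :
    ¬ IsBackwardSingularPoint v 0 :=
  not_backwardSingular_of_zero (eq_zero_of_pressure_nondecreasing_pressure hrate hcont hmild hdiv hp)

end Summit.NavierStokesRegularity.NavierStokesRegularity.Theorems.LocalHelicityTubeDoorFrobeniusProfileRigidityHeadMonotone

end
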